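/-
# GraphEquations — FREE SURGERY, primality of `I`, and the carved classes up to surgery (M17d, decomp-mm-lens-5 g30)

(supports `MultiplicityReduction`, stmt-MatrixMultiplication-27806, hand 1 = BOP′ at `K = 2`;
companion of `GraphEquationsTranslationPlumbing` — the moves recorded in the g30 memo §1.2/§4 as the
reason every explicit structural family written so far is already closed.)

A SURGERY of a system `E` is any fan-in-two system `E′` with
  `ideal(tests of E) ⊆ ideal(tests of E′) ⊆ I`                       (`EqSystem.SurgeryOf`).
It is FREE for hand 1: if `E` is CORRECT then so is `E′` (its zero set is squeezed between the graph
and `Z(E)`, `SurgeryOf.correct`), and ideal-initial isolation of any order over any base is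
inherited (`SurgeryOf.idealInitIsolatedAt`, by `IdealInitIsolatedSet.mono`).  Translate systems
(M17a) are surgeries (`TranslatesTo.surgeryOf`); so is RETESTING — designating other gate values of
the SAME program as tests, same cost (`retest`, `surgeryOf_retest`) — in particular STRIPPING A
FACTOR: a test `t = g · u` whose factor `u` lies in `I` may be replaced by `u`
(`surgeryOf_stripFactor`), and `u ∈ I` is automatic as soon as `g` does not vanish identically on
the graph, because `I` is PRIME (`graphIdeal_isPrime`: `I` is the kernel of the graph-restriction
homomorphism `constantCoeff ∘ Ψ⁻¹ : ℂ[A,B,C] → ℂ[A,B]` into a domain, `graphIdeal_eq_ker`); and so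
is SUBTRACTING one test from another at the price of one gate (`surgeryOf_subtract`).

Consequently each carved class C ∈ {row-split (M16b), const-deflatable (M16a), bounded twist (M17)}
upgrades for free to «some surgery of `E` lies in C»: `exists_reduced_of_surgery_rowSplit`,
`exists_reduced_of_surgery_constDeflatable`, `exists_reduced_of_surgery_boundedTwist` give a
CORRECT system REDUCED at the graph point over `y` with the class's cost bound in terms of
`cost E′`.  No new residual is typed here: these are moves for the prover of the hand-1 leaf
`UnboundedTwistCorrDeflation`, which may therefore assume that no cheap surgery of `E` is
row-split, const-deflatable over `y`, or of bounded twist at `y`.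
-/
import Mathlib
import Summits.MatrixMultiplication.Statement
import Summits.MatrixMultiplication.MatrixMultiplication.Theorems.GraphEquationsTranslationPlumbing

open scoped BigOperators

noncomputable section

set_option linter.dupNamespace false

namespace Summit.MatrixMultiplication.MatrixMultiplication.Theorems.GraphEquations

open MvPolynomial Literature.Computability.AlgebraicComplexity
open Literature.Computability.AlgebraicComplexity.ArithCircuit

variable {n : ℕ}

/-! ## `I` is prime -/

/-- `t ∈ I ⟺` the graph restriction `constantCoeff (Ψ⁻¹ t) ∈ ℂ[A,B]` vanishes. -/
theorem mem_graphIdeal_iff_constantCoeff_liftF (t : MvPolynomial (GraphVars n) ℂ) :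
    t ∈ graphIdeal n ↔ constantCoeff (liftF n t) = 0 := by
  rw [← substF_mem_graphIdeal_iff, substF_liftF]

/-- `I` is the kernel of the graph-restriction homomorphism `constantCoeff ∘ Ψ⁻¹`. -/
theorem graphIdeal_eq_ker :
    graphIdeal n = RingHom.ker ((constantCoeff : FPoly n →+* MvPolynomial (MatMulVars n) ℂ).comp
      (liftF n : MvPolynomial (GraphVars n) ℂ →+* FPoly n)) := by
  ext t
  rw [RingHom.mem_ker, RingHom.comp_apply, mem_graphIdeal_iff_constantCoeff_liftF]
  rfl

/-- **`I` is prime** (`ℂ[A,B]` is a domain). -/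
theorem graphIdeal_isPrime : (graphIdeal n).IsPrime := by
  rw [graphIdeal_eq_ker]
  exact RingHom.ker_isPrime _

/-- A polynomial not vanishing at some graph point is not in `I`. -/
theorem not_mem_graphIdeal_of_eval_ne_zero {g : MvPolynomial (GraphVars n) ℂ} {x : GraphVars n → ℂ}
    (hx : x ∈ mmGraph n) (hg : eval x g ≠ 0) : g ∉ graphIdeal n :=
  fun h => hg (eval_eq_zero_of_mem_graphIdeal h hx)

/-- **Factor stripping**: if `g · u ∈ I` and `g` does not vanish at some graph point, then `u ∈ I`. -/
theorem mem_graphIdeal_of_mul_mem {g u : MvPolynomial (GraphVars n) ℂ} (h : g * u ∈ graphIdeal n)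
    {x : GraphVars n → ℂ} (hx : x ∈ mmGraph n) (hg : eval x g ≠ 0) : u ∈ graphIdeal n :=
  (graphIdeal_isPrime.mem_or_mem h).resolve_left (not_mem_graphIdeal_of_eval_ne_zero hx hg)

namespace EqSystem

/-! ## Surgery -/

/-- `E′` is a SURGERY of `E`: fan-in two, every test of `E` lies in the ideal of the tests of `E′`,
and every test of `E′` lies in `I`. -/
def SurgeryOf (E E' : EqSystem n) : Prop :=
  E'.circuit.IsFanInTwo ∧ (∀ j ∈ E.tests, E.testPoly j ∈ Ideal.span E'.testSet) ∧
    (∀ j' ∈ E'.tests, E'.testPoly j' ∈ graphIdeal n)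

/-- The span of the tests of `E′` vanishes on `Z(E′)`. -/
theorem eval_eq_zero_of_mem_span_testSet {E' : EqSystem n} {x : GraphVars n → ℂ} (hx : x ∈ E'.zeroSet)
    {v : MvPolynomial (GraphVars n) ℂ} (hv : v ∈ Ideal.span E'.testSet) : eval x v = 0 := by
  rw [← RingHom.mem_ker]
  refine (Ideal.span_le.mpr fun s hs => ?_) hv
  obtain ⟨j', hj', rfl⟩ := (E'.mem_testSet_iff s).mp hs
  rw [SetLike.mem_coe, RingHom.mem_ker]
  exact hx j' hj'

/-- **Surgery preserves correctness**: `graph ⊆ Z(E′) ⊆ Z(E) = graph`. -/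
theorem SurgeryOf.correct {E E' : EqSystem n} (hE : E.Correct) (h : E.SurgeryOf E') : E'.Correct := by
  refine ⟨h.1, Set.ext fun x => ⟨fun hx => ?_, fun hx => ?_⟩⟩
  · rw [← hE.2]
    exact fun j hj => eval_eq_zero_of_mem_span_testSet hx (h.2.1 j hj)
  · exact fun j' hj' => eval_eq_zero_of_mem_graphIdeal (h.2.2 j' hj') hx

/-- The test ideal grows under surgery. -/
theorem SurgeryOf.span_le {E E' : EqSystem n} (h : E.SurgeryOf E') :
    Ideal.span E.testSet ≤ Ideal.span E'.testSet :=
  Ideal.span_le.mpr fun s hs => by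
    obtain ⟨j, hj, rfl⟩ := (E.mem_testSet_iff s).mp hs
    exact h.2.1 j hj

/-- **Surgery preserves ideal-initial isolation** of every order over every base. -/
theorem SurgeryOf.idealInitIsolatedAt {E E' : EqSystem n} (h : E.SurgeryOf E') {K : ℕ}
    {y : MatMulVars n → ℂ} (hiso : E.IdealInitIsolatedAt K y) : E'.IdealInitIsolatedAt K y :=
  (E'.idealInitIsolatedAt_iff K y).mpr (((E.idealInitIsolatedAt_iff K y).mp hiso).mono h.span_le)

/-- A correct system is a surgery of itself. -/
theorem SurgeryOf.refl {E : EqSystem n} (hE : E.Correct) : E.SurgeryOf E :=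
  ⟨hE.1, fun j hj => Ideal.subset_span ((E.mem_testSet_iff _).mpr ⟨j, hj, rfl⟩),
    fun _ hj => mem_graphIdeal_of_vanishing fun _ hx => hE.eval_testPoly_eq_zero hx hj⟩

/-- Surgeries compose. -/
theorem SurgeryOf.trans {E E' E'' : EqSystem n} (h : E.SurgeryOf E') (h' : E'.SurgeryOf E'') :
    E.SurgeryOf E'' :=
  ⟨h'.1, fun j hj => h'.span_le (h.2.1 j hj), h'.2.2⟩

/-- A system CONTAINING the tests of a correct `E`, all of whose tests lie in `I`, is a surgery
(corrected deflations restricted to `I`, M16b). -/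
theorem surgeryOf_of_contains {E E' : EqSystem n} (hfan : E'.circuit.IsFanInTwo)
    (hold : ∀ j ∈ E.tests, ∃ j' ∈ E'.tests, E'.testPoly j' = E.testPoly j)
    (hI : ∀ j' ∈ E'.tests, E'.testPoly j' ∈ graphIdeal n) : E.SurgeryOf E' :=
  ⟨hfan, fun j hj => by
    obtain ⟨j', hj', he⟩ := hold j hj
    exact Ideal.subset_span ((E'.mem_testSet_iff _).mpr ⟨j', hj', he⟩), hI⟩

/-- Translate systems (M17a) are surgeries. -/
theorem TranslatesTo.surgeryOf {E E' : EqSystem n} {Δ : List (MatMulVars n → ℂ)}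
    (h : E.TranslatesTo Δ E') (hE : E.Correct) (hfan : E'.circuit.IsFanInTwo) : E.SurgeryOf E' :=
  surgeryOf_of_contains hfan h.1 fun _ hj' =>
    mem_graphIdeal_of_vanishing fun _ hx => (h.correct hE hfan).eval_testPoly_eq_zero hx hj'

/-! ## Retesting: other gate values of the same program as tests -/

/-- The same program with test list `L`. -/
def retest (E : EqSystem n) (L : List ℕ) : EqSystem n := ⟨E.circuit, L⟩

/-- Same gate values. -/
@[simp] theorem retest_testPoly (E : EqSystem n) (L : List ℕ) (j : ℕ) :
    (E.retest L).testPoly j = E.testPoly j := rfl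

/-- Same cost. -/
@[simp] theorem retest_cost (E : EqSystem n) (L : List ℕ) : (E.retest L).cost = E.cost := rfl

/-- Same tests list as given. -/
@[simp] theorem retest_tests (E : EqSystem n) (L : List ℕ) : (E.retest L).tests = L := rfl

/-- **Retesting is a surgery** when the old tests lie in the span of the new ones and the new ones
lie in `I`. -/
theorem surgeryOf_retest {E : EqSystem n} (hE : E.Correct) {L : List ℕ}
    (hspan : ∀ j ∈ E.tests, E.testPoly j ∈ Ideal.span (E.retest L).testSet)
    (hI : ∀ i ∈ L, E.testPoly i ∈ graphIdeal n) : E.SurgeryOf (E.retest L) :=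
  ⟨hE.1, hspan, fun i hi => hI i hi⟩

/-- A gate value designated as a test of the retested system lies in its test span. -/
theorem testPoly_mem_span_retest (E : EqSystem n) {L : List ℕ} {i : ℕ} (hi : i ∈ L) :
    E.testPoly i ∈ Ideal.span (E.retest L).testSet :=
  Ideal.subset_span (((E.retest L).mem_testSet_iff _).mpr ⟨i, hi, rfl⟩)

/-- **STRIPPING A FACTOR.**  If test `j` of a correct `E` is the product of the gate values `g_i`
and `u_i` and `u_i ∈ I`, then replacing test `j` by `u_i` is a surgery (same program, same cost). -/
theorem surgeryOf_stripFactor {E : EqSystem n} (hE : E.Correct) {j gi ui : ℕ}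
    (hprod : E.testPoly j = E.testPoly gi * E.testPoly ui) (hu : E.testPoly ui ∈ graphIdeal n) :
    E.SurgeryOf (E.retest (ui :: E.tests.erase j)) := by
  refine surgeryOf_retest hE (fun j' hj' => ?_) fun i hi => ?_
  · by_cases hjj : j' = j
    · subst hjj
      rw [hprod]
      exact Ideal.mul_mem_left _ _ (E.testPoly_mem_span_retest List.mem_cons_self)
    · exact E.testPoly_mem_span_retest (List.mem_cons_of_mem _ ((List.mem_erase_of_ne hjj).mpr hj'))
  · rcases List.mem_cons.mp hi with rfl | hi
    · exact hu
    · exact mem_graphIdeal_of_vanishing fun x hx =>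
        hE.eval_testPoly_eq_zero hx (List.mem_of_mem_erase hi)

/-- The factor `u_i` lies in `I` as soon as the cofactor `g_i` does not vanish at some graph point
(`I` prime). -/
theorem factor_mem_graphIdeal {E : EqSystem n} (hE : E.Correct) {j gi ui : ℕ} (hj : j ∈ E.tests)
    (hprod : E.testPoly j = E.testPoly gi * E.testPoly ui) {x : GraphVars n → ℂ} (hx : x ∈ mmGraph n)
    (hg : eval x (E.testPoly gi) ≠ 0) : E.testPoly ui ∈ graphIdeal n :=
  mem_graphIdeal_of_mul_mem
    (hprod ▸ mem_graphIdeal_of_vanishing fun _ hz => hE.eval_testPoly_eq_zero hz hj) hx hg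

/-! ## Subtracting one test from another (one gate) -/

/-- The gate `t_j − t_k`. -/
def diffGate (j k : ℕ) : Gate ℂ (GraphVars n) := .sum [(1, .gate j), (-1, .gate k)]

/-- It has fan-in two. -/
theorem diffGate_fanIn (j k : ℕ) : (diffGate (n := n) j k).fanIn = 2 := rfl

/-- Its value. -/
theorem diffGate_eval (j k : ℕ) (vals : List (MvPolynomial (GraphVars n) ℂ)) :
    (diffGate (n := n) j k).eval vals = vals.getD j 0 - vals.getD k 0 := by
  simp [diffGate, Gate.eval, Operand.eval, sub_eq_add_neg]

/-- `E` with the gate `t_j − t_k` appended and test `j` replaced by it. -/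
def subtractTest (E : EqSystem n) (j k : ℕ) : EqSystem n :=
  ⟨⟨E.circuit.gates ++ [diffGate j k], E.circuit.output⟩, E.cost :: E.tests.erase j⟩

/-- Cost `+ 1`. -/
theorem subtractTest_cost (E : EqSystem n) (j k : ℕ) : (E.subtractTest j k).cost = E.cost + 1 := by
  simp [subtractTest, cost, ArithCircuit.size]

/-- Old gate values are unchanged. -/
theorem subtractTest_testPoly_of_lt (E : EqSystem n) (j k : ℕ) {i : ℕ} (hi : i < E.cost) :
    (E.subtractTest j k).testPoly i = E.testPoly i := by
  unfold testPoly subtractTest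
  exact getD_gateValues_append hi

/-- The new gate holds `t_j − t_k`. -/
theorem subtractTest_testPoly_new (E : EqSystem n) (j k : ℕ) :
    (E.subtractTest j k).testPoly E.cost = E.testPoly j - E.testPoly k := by
  unfold testPoly subtractTest
  simp only [gateValues_append_singleton, diffGate_eval]
  rw [List.getD_eq_getElem?_getD, List.getElem?_append_right (by simp [gateValues_length, cost,
    ArithCircuit.size]), gateValues_length]
  simp [cost, ArithCircuit.size]

/-- Beyond the new gate the values are junk `0`. -/
theorem subtractTest_testPoly_of_gt (E : EqSystem n) (j k : ℕ) {i : ℕ} (hi : E.cost < i) :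
    (E.subtractTest j k).testPoly i = 0 :=
  testPoly_eq_zero_of_le (by rw [subtractTest_cost]; omega)

/-- **SUBTRACTING A TEST is a surgery**: for tests `j ≠ k` of a correct `E` (genuine gate indices),
the system with test `j` replaced by the new gate `t_j − t_k` is a surgery of `E` of cost `+ 1`. -/
theorem surgeryOf_subtract {E : EqSystem n} (hE : E.Correct) {j k : ℕ} (hj : j ∈ E.tests)
    (hk : k ∈ E.tests) (hjk : k ≠ j) (hjc : j < E.cost) (hkc : k < E.cost) :
    E.SurgeryOf (E.subtractTest j k) := by
  have hfan : (E.subtractTest j k).circuit.IsFanInTwo := fun g hg => by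
    rcases List.mem_append.mp hg with hg | hg
    · exact hE.1 g hg
    · rw [List.mem_singleton.mp hg, diffGate_fanIn]
  have hI : ∀ i ∈ E.tests, E.testPoly i ∈ graphIdeal n := fun i hi =>
    mem_graphIdeal_of_vanishing fun x hx => hE.eval_testPoly_eq_zero hx hi
  -- membership of designated gate values in the new test span
  have hmem : ∀ i ∈ (E.subtractTest j k).tests,
      (E.subtractTest j k).testPoly i ∈ Ideal.span (E.subtractTest j k).testSet := fun i hi =>
    Ideal.subset_span (((E.subtractTest j k).mem_testSet_iff _).mpr ⟨i, hi, rfl⟩)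
  have htests : (E.subtractTest j k).tests = E.cost :: E.tests.erase j := rfl
  have hk' : k ∈ (E.subtractTest j k).tests :=
    htests ▸ List.mem_cons_of_mem _ ((List.mem_erase_of_ne hjk).mpr hk)
  have hnew : E.testPoly j - E.testPoly k ∈ Ideal.span (E.subtractTest j k).testSet := by
    rw [← subtractTest_testPoly_new]
    exact hmem _ (htests ▸ List.mem_cons_self)
  have hkspan : E.testPoly k ∈ Ideal.span (E.subtractTest j k).testSet := by
    rw [← E.subtractTest_testPoly_of_lt j k hkc]
    exact hmem _ hk'
  refine ⟨hfan, fun i hi => ?_, fun i hi => ?_⟩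
  · by_cases hij : i = j
    · subst hij
      have : E.testPoly i = (E.testPoly i - E.testPoly k) + E.testPoly k := by ring
      rw [this]
      exact Ideal.add_mem _ hnew hkspan
    · by_cases hic : i < E.cost
      · rw [← E.subtractTest_testPoly_of_lt j k hic]
        exact hmem _ (htests ▸ List.mem_cons_of_mem _ ((List.mem_erase_of_ne hij).mpr hi))
      · rw [testPoly_eq_zero_of_le (not_lt.mp hic)]
        exact Ideal.zero_mem _
  · rw [htests] at hi
    rcases List.mem_cons.mp hi with rfl | hi
    · rw [subtractTest_testPoly_new]
      exact Ideal.sub_mem _ (hI j hj) (hI k hk)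
    · have hi' : i ∈ E.tests := List.mem_of_mem_erase hi
      rcases lt_trichotomy i E.cost with hlt | heq | hgt
      · rw [E.subtractTest_testPoly_of_lt j k hlt]; exact hI i hi'
      · rw [heq, subtractTest_testPoly_new]; exact Ideal.sub_mem _ (hI j hj) (hI k hk)
      · rw [E.subtractTest_testPoly_of_gt j k hgt]; exact Ideal.zero_mem _

/-! ## The carved classes up to surgery -/

/-- **Row-split up to surgery** (M16b on the surgery). -/
theorem exists_reduced_of_surgery_rowSplit {E E' : EqSystem n} {y : MatMulVars n → ℂ}
    (hE : E.Correct) (hiso : E.IdealInitIsolatedAt 2 y) (h : E.SurgeryOf E') (hsplit : E'.RowSplit) :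
    ∃ E'' : EqSystem n, E''.Correct ∧ E''.ReducedAt (graphPoint y) ∧ E''.cost ≤ 4 * E'.cost + n * n :=
  exists_reduced_corrDeflation_of_rowSplit (h.correct hE) (h.idealInitIsolatedAt hiso) hsplit

/-- **Const-deflatable up to surgery** (M16a R1 on the surgery). -/
theorem exists_reduced_of_surgery_constDeflatable {E E' : EqSystem n} {y : MatMulVars n → ℂ}
    (hE : E.Correct) (h : E.SurgeryOf E') (hcd : E'.ConstDeflatable y) :
    ∃ E'' : EqSystem n, E''.Correct ∧ E''.ReducedAt (graphPoint y) ∧ E''.cost ≤ 4 * E'.cost + n * n :=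
  exists_reduced_deflation_of_constDeflatable (h.correct hE) hcd

/-- **Bounded twist up to surgery** (M17 on the surgery). -/
theorem exists_reduced_of_surgery_boundedTwist {E E' : EqSystem n} {y : MatMulVars n → ℂ} {T₀ s₀ : ℕ}
    (hE : E.Correct) (hiso : E.IdealInitIsolatedAt 2 y) (h : E.SurgeryOf E')
    (hB : E'.BoundedTwist T₀ s₀ y) :
    ∃ E'' : EqSystem n, E''.Correct ∧ E''.ReducedAt (graphPoint y) ∧
      E''.cost ≤ 4 * ((T₀ + 1) * E'.cost + 4 * n * s₀ * T₀) + n * n :=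
  exists_reduced_deflation_of_boundedTwist' (h.correct hE) (h.idealInitIsolatedAt hiso) hB

/-- **Pure isolated of order `2` up to surgery**: any of the three classes reached by a surgery of a
correct order-`2` system yields a CORRECT system PURE ISOLATED of order `2` (what `EqAdmissiblePure`
asks), with the displayed cost. -/
theorem exists_pure_two_of_surgery {E E' : EqSystem n} {y : MatMulVars n → ℂ} {T₀ s₀ : ℕ}
    (hE : E.Correct) (hiso : E.IdealInitIsolatedAt 2 y) (h : E.SurgeryOf E')
    (hcls : E'.RowSplit ∨ E'.ConstDeflatable y ∨ E'.BoundedTwist T₀ s₀ y) :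
    ∃ E'' : EqSystem n, E''.Correct ∧ E''.PureIsolated 2 ∧
      E''.cost ≤ 4 * ((T₀ + 1) * E'.cost + 4 * n * s₀ * T₀) + n * n := by
  have h1 : E'.cost ≤ (T₀ + 1) * E'.cost + 4 * n * s₀ * T₀ :=
    (Nat.le_mul_of_pos_left _ (Nat.succ_pos _)).trans (Nat.le_add_right _ _)
  have hle : 4 * E'.cost + n * n ≤ 4 * ((T₀ + 1) * E'.cost + 4 * n * s₀ * T₀) + n * n :=
    Nat.add_le_add_right (Nat.mul_le_mul_left 4 h1) _
  rcases hcls with hs | hc | hb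
  · obtain ⟨E'', h1, h2, h3⟩ := exists_reduced_of_surgery_rowSplit hE hiso h hs
    exact ⟨E'', h1, pureIsolated_of_reducedAt_graphPoint h1 h2 le_rfl, h3.trans hle⟩
  · obtain ⟨E'', h1, h2, h3⟩ := exists_reduced_of_surgery_constDeflatable hE h hc
    exact ⟨E'', h1, pureIsolated_of_reducedAt_graphPoint h1 h2 le_rfl, h3.trans hle⟩
  · obtain ⟨E'', h1, h2, h3⟩ := exists_reduced_of_surgery_boundedTwist hE hiso h hb
    exact ⟨E'', h1, pureIsolated_of_reducedAt_graphPoint h1 h2 le_rfl, h3⟩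

end EqSystem

end Summit.MatrixMultiplication.MatrixMultiplication.Theorems.GraphEquations
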